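import Summits.AtomisticToContinuum.Crystallization.Theses.FlatToriSuffice
import Literature.MathematicalPhysics.StatisticalMechanics.PeriodicConfigurationSums

/-!
# Route FlatToriSuffice — item `TorusDefectGapSplitGlue` (stmt-AtomisticToContinuum-17671)

`CrysPeriodicMinAttained → TwoShellDefectGap → TwoShellLocalRules → PricedClosePairs → TorusDefectGap`:
the PROVED assembly of the scale-seam split of the deciding crux `TorusDefectGap` (crux-strategist BC2
redirect, 2026-08-17; same proof as `Cruxes/TorusDefectGap/SplitAssembly.lean`, restated against the
route decls so that it lands under `Theorems/` without importing a Cruxes module). Torus counting: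
`#bad_(R,ε) ≤ #D_r + (2L/r+1)³ · #bad_(2,η)` (lattice-invariance of goodness, packing bound per fibre of
the charging map via `card_le_of_separated_of_dist_le`), closed by the two priced counts. [folklore]
-/

noncomputable section

open scoped BigOperators Classical
open Set Metric

namespace Summit.AtomisticToContinuum.Crystallization.Theorems.FlatToriSufficeSplit

open Literature.MathematicalPhysics.StatisticalMechanics

local notation "E3" => EuclideanSpace ℝ (Fin 3)
local notation "PC" => Literature.MathematicalPhysics.StatisticalMechanics.PeriodicConfiguration 3

open Summit.AtomisticToContinuum.Crystallization.Theses.FlatToriSuffice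
  (TorusDefectGap TwoShellDefectGap CrysPeriodicMinAttained TorusDefectGapSplitGlue)

/-- `(R, ε)`-goodness of a point `x` of `P` relative to the reference configuration `P₀`: the
radius-`R` environment of `x` in `P.points` is `ε`-matched both ways, after a linear isometry `A`,
to the environment of some motif site `p₀` of `P₀` (the matching clauses of `TorusDefectGap`). -/
def Good (P₀ P : PC) (R ε : ℝ) (x : E3) : Prop :=
  ∃ p₀ ∈ P₀.motif, ∃ A : E3 ≃ₗᵢ[ℝ] E3,
    (∀ p ∈ P₀.points, dist p p₀ ≤ R → ∃ y ∈ P.points, dist y (x + A (p - p₀)) ≤ ε) ∧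
    (∀ y ∈ P.points, dist y x ≤ R → ∃ p ∈ P₀.points, dist y (x + A (p - p₀)) ≤ ε)

/-- `P₀` minimises the Lennard-Jones energy per particle among periodic configurations. -/
def IsMin (P₀ : PC) : Prop :=
  IsLeast (Set.range fun Q : PC => Q.energyPerParticle lennardJones)
    (P₀.energyPerParticle lennardJones)

/-- Piece L — ROBUST TWO-SHELL LOCAL RULES at every periodic minimiser. -/
def TwoShellLocalRules : Prop :=
  ∀ P₀ : PC, IsMin P₀ → ∀ R ε : ℝ, 0 < R → 0 < ε → ∃ η L : ℝ, 0 < η ∧ 0 < L ∧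
    ∀ P : PC, ∀ x ∈ P.points,
      (∀ y ∈ P.points, dist y x ≤ L → Good P₀ P 2 η y) → Good P₀ P R ε x

/-- Piece C — PRICED CLOSE PAIRS at every periodic minimiser. -/
def PricedClosePairs : Prop :=
  ∀ P₀ : PC, IsMin P₀ → ∃ r c : ℝ, 0 < r ∧ 0 < c ∧ ∀ P : PC,
    c * ({x : E3 | x ∈ P.motif ∧ ∃ z ∈ P.points, z ≠ x ∧ dist z x < r}.ncard : ℝ)
      ≤ (P.motif.card : ℝ) *
        (P.energyPerParticle lennardJones - P₀.energyPerParticle lennardJones)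

/-! ## Lemmas -/

/-- Goodness is invariant under the lattice of periods of `P`. -/
theorem good_add_of_mem_lattice {P₀ P : PC} {R ε : ℝ} {x g : E3} (hg : g ∈ P.lattice)
    (h : Good P₀ P R ε x) : Good P₀ P R ε (x + g) := by
  obtain ⟨p₀, hp₀, A, h1, h2⟩ := h
  refine ⟨p₀, hp₀, A, fun p hp hpR => ?_, fun y hy hyR => ?_⟩
  · obtain ⟨y, hy, hyd⟩ := h1 p hp hpR
    refine ⟨y + g, P.add_mem_points hy hg, ?_⟩
    have : x + g + A (p - p₀) = (x + A (p - p₀)) + g := by abel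
    rw [this, dist_add_right]
    exact hyd
  · have hy' : y - g ∈ P.points := by
      simpa [sub_eq_add_neg] using P.add_mem_points hy (P.lattice.neg_mem hg)
    have hd : dist (y - g) x ≤ R := by
      have : dist (y - g) x = dist y (x + g) := by
        rw [dist_eq_norm, dist_eq_norm]; congr 1; abel
      rw [this]; exact hyR
    obtain ⟨p, hp, hpd⟩ := h2 (y - g) hy' hd
    refine ⟨p, hp, ?_⟩
    have : dist y (x + g + A (p - p₀)) = dist (y - g) (x + A (p - p₀)) := by
      rw [dist_eq_norm, dist_eq_norm]; congr 1; abel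
    rw [this]; exact hpd

/-- `{x | x ∈ s ∧ q x}.ncard` is the cardinality of the filtered finset. -/
theorem ncard_setOf_mem_and (s : Finset E3) (q : E3 → Prop) [DecidablePred q] :
    {x : E3 | x ∈ s ∧ q x}.ncard = (s.filter q).card := by
  rw [← Set.ncard_coe_finset]
  congr 1
  ext x
  simp

/-- **Packing bound for one fibre of the charging map.** If every `x ∈ F` is a motif point of `P`
with no other point of `P` within distance `< r`, and has a point `y_x ∈ P.points` within `L`
which is a lattice translate of the fixed point `m`, then `#F ≤ (2L/r + 1)³`: the points
`x - y_x + m` are points of `P` in the ball `B̄(m, L)`, pairwise distinct (motif points are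
inequivalent mod the lattice) and `r`-separated (isolation is lattice-invariant). -/
theorem card_fibre_le (P : PC) (m : E3) {r L : ℝ} (hr : 0 < r) (hL : 0 ≤ L)
    (F : Finset E3)
    (hFmotif : ∀ x ∈ F, x ∈ P.motif)
    (hFiso : ∀ x ∈ F, ∀ z ∈ P.points, z ≠ x → r ≤ dist z x)
    (hFnear : ∀ x ∈ F, ∃ y ∈ P.points, dist y x ≤ L ∧ y - m ∈ P.lattice) :
    (F.card : ℝ) ≤ (2 * L / r + 1) ^ 3 := by
  choose! yf hyP hyd hyl using hFnear
  set φ : E3 → E3 := fun x => x - yf x + m with hφ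
  have hφpts : ∀ x ∈ F, φ x ∈ P.points := fun x hx => by
    have : φ x = x + (-(yf x - m)) := by simp only [hφ]; abel
    rw [this]
    exact P.add_mem_points (P.mem_points_of_mem_motif (hFmotif x hx))
      (P.lattice.neg_mem (hyl x hx))
  have hφdist : ∀ x ∈ F, dist (φ x) m ≤ L := fun x hx => by
    have : dist (φ x) m = dist (yf x) x := by
      simp only [hφ]
      rw [dist_eq_norm, dist_eq_norm, ← norm_neg]
      congr 1
      abel
    rw [this]
    exact hyd x hx
  have hφinj : Set.InjOn φ F := fun x₁ hx₁ x₂ hx₂ heq => by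
    have h' : x₁ - yf x₁ = x₂ - yf x₂ := add_right_cancel heq
    have h12 : x₁ - x₂ = (yf x₁ - m) - (yf x₂ - m) := by
      calc x₁ - x₂ = (x₁ - yf x₁) - (x₂ - yf x₂) + (yf x₁ - yf x₂) := by abel
        _ = (yf x₁ - m) - (yf x₂ - m) := by rw [h']; abel
    apply P.eq_of_sub_mem x₁ (hFmotif x₁ hx₁) x₂ (hFmotif x₂ hx₂)
    rw [h12]
    exact P.lattice.sub_mem (hyl x₁ hx₁) (hyl x₂ hx₂)
  have hsep : ∀ c ∈ F.image φ, ∀ d ∈ F.image φ, c ≠ d → r ≤ dist c d := by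
    intro c hc d hd hcd
    obtain ⟨x₁, hx₁, rfl⟩ := Finset.mem_image.1 hc
    obtain ⟨x₂, hx₂, rfl⟩ := Finset.mem_image.1 hd
    set z : E3 := x₂ + (yf x₁ - m - (yf x₂ - m)) with hz
    have hzP : z ∈ P.points :=
      P.add_mem_points (P.mem_points_of_mem_motif (hFmotif x₂ hx₂))
        (P.lattice.sub_mem (hyl x₁ hx₁) (hyl x₂ hx₂))
    have hdz : dist (φ x₁) (φ x₂) = dist z x₁ := by
      simp only [hφ, hz]
      rw [dist_eq_norm, dist_eq_norm, ← norm_neg]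
      congr 1
      abel
    have hzx : z ≠ x₁ := fun h => hcd (by
      have h0 : dist (φ x₁) (φ x₂) = 0 := by rw [hdz, h, dist_self]
      exact dist_eq_zero.1 h0)
    rw [hdz]
    exact hFiso x₁ hx₁ z hzP hzx
  have hball : ∀ c ∈ F.image φ, dist c m ≤ L := by
    intro c hc
    obtain ⟨x, hx, rfl⟩ := Finset.mem_image.1 hc
    exact hφdist x hx
  have key := card_le_of_separated_of_dist_le (F.image φ) m hr hL hball hsep
  rw [Finset.card_image_of_injOn hφinj, finrank_euclideanSpace_fin] at key
  exact key

/-- **The torus counting argument.** With the robust local rules in force (every point all of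
whose `L`-neighbours are `(2, η)`-good is `(R, ε)`-good), the `(R, ε)`-bad motif points of `P`
number at most `#D + (2L/r + 1)³ · #bad₂`, where `D` is the set of motif points with another
point of `P` within distance `< r` and `bad₂` the set of `(2, η)`-bad motif points: an isolated
bad point `x` has a `(2, η)`-bad point of `P` within `L`, whose motif representative `m` is bad
too (goodness is lattice-invariant); charging `x` to `m`, each fibre is bounded by the packing
lemma `card_fibre_le`. -/
theorem card_bad_le (P₀ P : PC) {R ε η L r : ℝ} (hr : 0 < r) (hL : 0 < L)
    (hrules : ∀ x ∈ P.points, (∀ y ∈ P.points, dist y x ≤ L → Good P₀ P 2 η y) →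
      Good P₀ P R ε x) :
    ({x : E3 | x ∈ P.motif ∧ ¬ Good P₀ P R ε x}.ncard : ℝ) ≤
      {x : E3 | x ∈ P.motif ∧ ∃ z ∈ P.points, z ≠ x ∧ dist z x < r}.ncard
        + (2 * L / r + 1) ^ 3 * {x : E3 | x ∈ P.motif ∧ ¬ Good P₀ P 2 η x}.ncard := by
  have e1 := ncard_setOf_mem_and P.motif (fun x => ¬ Good P₀ P R ε x)
  have e2 := ncard_setOf_mem_and P.motif (fun x => ¬ Good P₀ P 2 η x)
  have e3 := ncard_setOf_mem_and P.motif (fun x => ∃ z ∈ P.points, z ≠ x ∧ dist z x < r)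
  rw [e1, e2, e3]
  set bad := P.motif.filter fun x => ¬ Good P₀ P R ε x with hbad
  set D := P.motif.filter fun x => ∃ z ∈ P.points, z ≠ x ∧ dist z x < r with hD
  set bad₂ := P.motif.filter fun x => ¬ Good P₀ P 2 η x with hbad₂
  set K : ℝ := (2 * L / r + 1) ^ 3 with hK
  set S := bad.filter fun x => ¬ ∃ z ∈ P.points, z ≠ x ∧ dist z x < r with hS
  set F : E3 → Finset E3 := fun m =>
    S.filter fun x => ∃ y ∈ P.points, dist y x ≤ L ∧ y - m ∈ P.lattice with hF
  have hsplit : bad.card ≤ D.card + S.card := by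
    have hcov : bad ⊆ D ∪ S := by
      intro x hx
      rw [Finset.mem_union]
      by_cases hq : ∃ z ∈ P.points, z ≠ x ∧ dist z x < r
      · left
        simp only [hbad, hD, Finset.mem_filter] at hx ⊢
        exact ⟨hx.1, hq⟩
      · right
        simp only [hS, Finset.mem_filter]
        exact ⟨hx, hq⟩
    exact (Finset.card_le_card hcov).trans (Finset.card_union_le _ _)
  have hcover : S ⊆ bad₂.biUnion F := by
    intro x hx
    have hxS := hx
    simp only [hS, hbad, Finset.mem_filter] at hx
    obtain ⟨⟨hxm, hxbad⟩, -⟩ := hx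
    have hxP : x ∈ P.points := P.mem_points_of_mem_motif hxm
    have h' : ¬ ∀ y ∈ P.points, dist y x ≤ L → Good P₀ P 2 η y :=
      fun h => hxbad (hrules x hxP h)
    push Not at h'
    obtain ⟨y, hyP, hyd, hybad⟩ := h'
    obtain ⟨m, hm, hym⟩ := P.exists_sub_mem_lattice hyP
    have hmbad : ¬ Good P₀ P 2 η m := fun hgood => hybad (by
      have h'' := good_add_of_mem_lattice hym hgood
      rwa [add_sub_cancel] at h'')
    refine Finset.mem_biUnion.2 ⟨m, ?_, ?_⟩
    · simp only [hbad₂, Finset.mem_filter]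
      exact ⟨hm, hmbad⟩
    · simp only [hF, Finset.mem_filter]
      exact ⟨hxS, y, hyP, hyd, hym⟩
  have hfibre : ∀ m ∈ bad₂, ((F m).card : ℝ) ≤ K := by
    intro m _
    apply card_fibre_le P m hr hL.le (F m)
    · intro x hx
      simp only [hF, hS, hbad, Finset.mem_filter] at hx
      exact hx.1.1.1
    · intro x hx z hz hzx
      simp only [hF, hS, hbad, Finset.mem_filter] at hx
      have hiso := hx.1.2
      by_contra hlt
      push Not at hlt
      exact hiso ⟨z, hz, hzx, hlt⟩
    · intro x hx
      simp only [hF, Finset.mem_filter] at hx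
      exact hx.2
  have hScard : (S.card : ℝ) ≤ K * bad₂.card := by
    calc (S.card : ℝ) ≤ ((bad₂.biUnion F).card : ℝ) := by
          exact_mod_cast Finset.card_le_card hcover
      _ ≤ ∑ m ∈ bad₂, ((F m).card : ℝ) := by
          exact_mod_cast Finset.card_biUnion_le
      _ ≤ ∑ m ∈ bad₂, K := Finset.sum_le_sum hfibre
      _ = K * bad₂.card := by rw [Finset.sum_const, nsmul_eq_mul, mul_comm]
  calc (bad.card : ℝ) ≤ D.card + S.card := by exact_mod_cast hsplit
    _ ≤ D.card + K * bad₂.card := by linarith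

/-- The closing real arithmetic: `B ≤ D + K B₂`, `c D ≤ Δ`, `g₂ B₂ ≤ Δ` give
`(c⁻¹ + K g₂⁻¹)⁻¹ B ≤ Δ`. -/
theorem gap_arith {B B₂ Dn Δ c g₂ K : ℝ} (hc : 0 < c) (hg : 0 < g₂) (hK : 0 ≤ K)
    (h1 : B ≤ Dn + K * B₂) (h2 : c * Dn ≤ Δ) (h3 : g₂ * B₂ ≤ Δ) :
    (c⁻¹ + K * g₂⁻¹)⁻¹ * B ≤ Δ := by
  have hM : 0 < c⁻¹ + K * g₂⁻¹ := by positivity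
  have hDn : Dn ≤ Δ / c := by rw [le_div_iff₀ hc]; linarith
  have hB₂ : B₂ ≤ Δ / g₂ := by rw [le_div_iff₀ hg]; linarith
  have hB : B ≤ (c⁻¹ + K * g₂⁻¹) * Δ := by
    calc B ≤ Dn + K * B₂ := h1
      _ ≤ Δ / c + K * (Δ / g₂) := by gcongr
      _ = (c⁻¹ + K * g₂⁻¹) * Δ := by ring
  calc (c⁻¹ + K * g₂⁻¹)⁻¹ * B ≤ (c⁻¹ + K * g₂⁻¹)⁻¹ * ((c⁻¹ + K * g₂⁻¹) * Δ) := by gcongr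
    _ = Δ := by rw [← mul_assoc, inv_mul_cancel₀ hM.ne', one_mul]

/-- **Split assembly** (pieces stated with the abbreviation `Good`). -/
theorem torusDefectGap_of_pieces' (hE : CrysPeriodicMinAttained) (hT : TwoShellDefectGap)
    (hL : TwoShellLocalRules) (hC : PricedClosePairs) : TorusDefectGap := by
  obtain ⟨P₀, hmin⟩ := hE
  refine ⟨P₀, fun R ε hR hε => ?_⟩
  obtain ⟨η, L, hη, hLpos, hrules⟩ := hL P₀ hmin R ε hR hε
  obtain ⟨g₂, hg₂, hgap₂⟩ := hT P₀ hmin η hη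
  obtain ⟨r, c, hr, hc, hclose⟩ := hC P₀ hmin
  have hK : (0 : ℝ) ≤ (2 * L / r + 1) ^ 3 := by positivity
  refine ⟨(c⁻¹ + (2 * L / r + 1) ^ 3 * g₂⁻¹)⁻¹, by positivity, fun P => ?_⟩
  have h2 : g₂ * ({x : E3 | x ∈ P.motif ∧ ¬ Good P₀ P 2 η x}.ncard : ℝ) ≤
      (P.motif.card : ℝ) *
        (P.energyPerParticle lennardJones - P₀.energyPerParticle lennardJones) := hgap₂ P
  have hD := hclose P
  have hcount := card_bad_le P₀ P (R := R) (ε := ε) hr hLpos (hrules P)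
  exact gap_arith hc hg₂ hK hcount hD h2

/-- **Item `TorusDefectGapSplitGlue`** (stmt-AtomisticToContinuum-17671, route FlatToriSuffice):
`CrysPeriodicMinAttained → TwoShellDefectGap → TwoShellLocalRules → PricedClosePairs → TorusDefectGap`
(the route's `TwoShellLocalRules` / `PricedClosePairs` unfold definitionally to the `Good`-based
statements used above). [folklore] -/
theorem torusDefectGapSplitGlue_proof : TorusDefectGapSplitGlue :=
  fun hE hT hL hC => torusDefectGap_of_pieces' hE hT hL hC

end Summit.AtomisticToContinuum.Crystallization.Theorems.FlatToriSufficeSplit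

end
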